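import Summits.ResolutionOfSingularities.ResolutionOfSingularities.Theorems.PurelyInseparableDim4MohAlongComposite
import HarnessLib

/-!
# Purely inseparable four-folds — Moh's stability theorem for FINITE fibre chains, and the re-based bound
# along nested, revisit-free zigzag branches (PR-1 (b), honest-chain form)

[OURS · counted 0 · cell `res-dim4-pi`, D-0157 DOOR 2, brick PR-1 (b); AI work, weaker than expert review]
Nothing here is a statement about resolution of singularities (NOT proved in dimension `≥ 4` /
characteristic `p` anywhere in this programme).

* §1 `shade_le_shade_add_one_along_fin` — the tree's `CentreBlowup.shade_le_shade_add_one_along`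
  (Moh's Stability Theorem at order `p`, fibre points) for a FINITE horizon: hypotheses only at the
  stages `k < m` (the engines' branches are finite; the tree's statement quantifies over an infinite
  sequence). Same proof (jump creates Moh's witness, witness forbids a jump and survives stalls).
* §2 the HONEST CHAIN of a zigzag branch `s_{k+1} = step p S_k j_k (b'_k + c_k) s_k` up to stage `m`:
  the accumulated moves `Γ_k` (`Γ_m = 0`, `Γ_k = c_k + Γ_{k+1}|_{S_kᶜ}`) and the re-based states
  `σ_k = s_k@Γ_k`; under NESTING (`Γ_{k+1}(j_k) = 0`: each new exceptional component lies in the later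
  centres as far as the moves see it) and NO REVISIT (`(b'_k + c_k)_i + Γ_{k+1,i} = 0 ⇒ (b'_k + c_k)_i = 0`,
  no boundary amnesia) the re-based states form a FIBRE chain (`rebase_succ`, from
  `translate_step_add_eq`), whence **`shade_le_shade_rebase_add_one`**: `shade(s_m) ≤ shade(s_n@Γ_n) + 1`
  for `n ≤ m`, given (1) at every `s_k` and (2) at every re-based state. The baseline of Moh's `+1`
  along a zigzag is the ROOT STATE MOVED TO THE COMPOSITE IMAGE POINT, not the root state itself — the
  census' «double rises» on translated branches are measured against the wrong baseline unless
  `Γ_n` is silent for `s_n`.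

bears_on: LADDER-RESOLUTION:D157-DOOR2 (res-dim4-pi · PR-1 (b)). Supports
stmt-ResolutionOfSingularities-16155 (helper).
-/

set_option linter.dupNamespace false

noncomputable section

open MvPolynomial Finset

open scoped BigOperators

namespace Summit.ResolutionOfSingularities.ResolutionOfSingularities.Theorems.PIDim4

open Literature.AlgebraicGeometry.Resolution
open Literature.AlgebraicGeometry.Resolution.Hauser2010
open Literature.AlgebraicGeometry.Resolution.CentreBlowup
open Literature.Barriers.ResolutionOfSingularities

namespace MohAlong

/-! ## 1. Moh's stability along a finite fibre chain -/

section Finite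

variable {σ : Type*} {K : Type*} [Field K] [Fintype σ] [DecidableEq σ] [DecidableEq K]
variable (p : ℕ) [hp : Fact p.Prime] [CharP K p]

/-- **Moh's Stability Theorem (`e = 1`) along a FINITE chain of fibre-point blow-ups of Moh-permissible
coordinate centres**: the tree's `CentreBlowup.shade_le_shade_add_one_along` with hypotheses only at
the stages `k < m`. [cite: Moh1987, Stability Theorem (Introduction p. 966) and §1 (pp. 972–973)] -/
theorem shade_le_shade_add_one_along_fin (s : ℕ → CState σ K) (S : ℕ → Finset σ) (j : ℕ → σ)
    (b : ℕ → σ → K) (m : ℕ) (hj : ∀ k, k < m → j k ∈ S k) (hb : ∀ k, k < m → b k (j k) = 0)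
    (hbN : ∀ k, k < m → ∀ i, i ∉ S k → b k i = 0)
    (hstep : ∀ k, k < m → s (k + 1) = step p (S k) (j k) (b k) (s k))
    (hF0 : (s 0).F ≠ 0) (hclean : deletePthPowers p (s 0).F = (s 0).F)
    (hr : ∀ d ∈ (s 0).F.support, (s 0).r ≤ d)
    (hq : ∀ k, k < m → ∀ d ∈ (s k).F.support, p ≤ degIn (S k) d)
    (hperm : ∀ k, k < m → ∀ d ∈ (s k).F.support,
      ((degIn (S k) (s k).r : ℕ) : ℕ∞) + (s k).shade ≤ (degIn (S k) d : ℕ))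
    {n : ℕ} (hnm : n ≤ m) : (s m).shade ≤ (s n).shade + 1 := by
  have hpermN : ∀ k, k < m → ∀ (o : ℕ), ordZero (s k).F = o → ∀ d ∈ (s k).F.support,
      degIn (S k) (s k).r + (o - (s k).r.degree) ≤ degIn (S k) d := by
    intro k hk o ho d hd
    have h := hperm k hk d hd
    rw [CState.shade_eq_of_ordZero_eq _ ho] at h
    exact_mod_cast h
  -- invariants up to the horizon
  have hinv : ∀ k, k ≤ m → ((s k).F ≠ 0 ∧ deletePthPowers p (s k).F = (s k).F ∧
      ∀ d ∈ (s k).F.support, (s k).r ≤ d) := by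
    intro k
    induction k with
    | zero => exact fun _ => ⟨hF0, hclean, hr⟩
    | succ k ih =>
      intro hk
      have hk' : k < m := Nat.lt_of_succ_le hk
      obtain ⟨ih0, ih1, ih2⟩ := ih hk'.le
      obtain ⟨o, ho⟩ := exists_ordZero_eq_natCast ih0
      rw [hstep k hk']
      exact ⟨step_F_ne_zero p (hj k hk') (b k) (hb k hk') (hbN k hk') (s k) ih1 ho ih2 (hq k hk'),
        deletePthPowers_step p (S k) (j k) (b k) (s k),
        newMult_le_of_mem_support_step p (S k) (j k) (b k) (hb k hk') (s k) ho ih2 (hpermN k hk' o ho)⟩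
  let W : CState σ K → Prop := fun t =>
    ∃ (i : σ) (o : ℕ) (E : σ →₀ ℕ), ordZero t.F = o ∧ E ∈ t.F.support ∧ E.degree = o ∧
      ¬ p ∣ E i ∧ t.r i = 0
  obtain ⟨a, ha⟩ := exists_ordZero_eq_natCast (hinv n hnm).1
  have hshade_n : (s n).shade = ((a - (s n).r.degree : ℕ) : ℕ∞) :=
    CState.shade_eq_of_ordZero_eq _ ha
  suffices main : ∀ k, n + k ≤ m → ((s (n + k)).shade ≤ (s n).shade + 1 ∧
      ((s (n + k)).shade = (s n).shade + 1 → W (s (n + k)))) by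
    obtain ⟨k, hk⟩ := Nat.exists_eq_add_of_le hnm
    rw [hk]
    exact (main k (by omega)).1
  intro k
  induction k with
  | zero =>
    intro _
    refine ⟨le_self_add, fun h => ?_⟩
    exfalso
    rw [Nat.add_zero, hshade_n] at h
    have : (a - (s n).r.degree : ℕ) = (a - (s n).r.degree) + 1 := by exact_mod_cast h
    omega
  | succ k ih =>
    intro hk
    have hlt : n + k < m := by omega
    obtain ⟨ih1, ih2⟩ := ih hlt.le
    obtain ⟨-, hcl, hrk⟩ := hinv (n + k) hlt.le
    obtain ⟨o, ho⟩ := exists_ordZero_eq_natCast (hinv (n + k) hlt.le).1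
    have hpk := hpermN (n + k) hlt o ho
    have hstepk : s (n + (k + 1)) = step p (S (n + k)) (j (n + k)) (b (n + k)) (s (n + k)) := by
      rw [← Nat.add_assoc]; exact hstep (n + k) hlt
    have hshade_k : (s (n + k)).shade = ((o - (s (n + k)).r.degree : ℕ) : ℕ∞) :=
      CState.shade_eq_of_ordZero_eq _ ho
    by_cases htop : (s (n + k)).shade = (s n).shade + 1
    · obtain ⟨i₀, o', E, ho', hE, hEdeg, hEi, hri⟩ := ih2 htop
      have hoo : o' = o := by
        have := ho'.symm.trans ho
        exact_mod_cast this
      subst hoo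
      have hle := shade_step_le_of_witness p (hj _ hlt) (b (n + k)) (hb _ hlt) (hbN _ hlt)
        (s (n + k)) ho' hrk (hq _ hlt) hpk hri hE hEdeg hEi
      rw [← hstepk] at hle
      refine ⟨le_trans hle (le_of_eq htop), fun heq => ?_⟩
      have hstall : (step p (S (n + k)) (j (n + k)) (b (n + k)) (s (n + k))).shade
          = (s (n + k)).shade := by
        rw [← hstepk, heq, htop]
      obtain ⟨i₁, o₁, E₁, ho₁, hE₁, hE₁deg, hE₁i, hr₁⟩ :=
        exists_witness_step_of_shade_eq p (hj _ hlt) (b (n + k)) (hb _ hlt) (hbN _ hlt)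
          (s (n + k)) hcl ho' hrk (hq _ hlt) hpk hri hE hEdeg hEi hstall
      rw [← hstepk] at ho₁ hE₁ hr₁
      exact ⟨i₁, o₁, E₁, ho₁, hE₁, hE₁deg, hE₁i, hr₁⟩
    · have hlt' : (s (n + k)).shade < (s n).shade + 1 := lt_of_le_of_ne ih1 htop
      have hle : (s (n + k)).shade ≤ (s n).shade := by
        rw [hshade_k, hshade_n] at hlt' ⊢
        have : (o - (s (n + k)).r.degree : ℕ) < (a - (s n).r.degree) + 1 := by exact_mod_cast hlt'
        exact_mod_cast (by omega : (o - (s (n + k)).r.degree : ℕ) ≤ (a - (s n).r.degree))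
      have hM := mohBound_one p (hj _ hlt) (b (n + k)) (hb _ hlt) (hbN _ hlt) (s (n + k))
        hcl ho hrk (hq _ hlt) hpk
      rw [← hstepk] at hM
      refine ⟨le_trans hM (add_le_add hle le_rfl), fun heq => ?_⟩
      have hinc : ShadeIncreases p (S (n + k)) (j (n + k)) (b (n + k)) (s (n + k)) := by
        unfold ShadeIncreases
        rw [← hstepk, heq]
        exact lt_of_le_of_lt hle (by
          rw [hshade_n]
          exact_mod_cast (by omega : (a - (s n).r.degree : ℕ) < (a - (s n).r.degree) + 1))
      obtain ⟨i₀, o₁, E, ho₁, hE, hEdeg, hEi₀, hr1i₀⟩ :=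
        exists_witness_of_shadeIncreases p (hj _ hlt) (b (n + k)) (hb _ hlt) (hbN _ hlt)
          (s (n + k)) hcl ho hrk (hq _ hlt) hpk hinc
      rw [← hstepk] at ho₁ hE hr1i₀
      exact ⟨i₀, o₁, E, ho₁, hE, hEdeg, hEi₀, hr1i₀⟩

end Finite

/-! ## 2. The honest chain of a zigzag branch and the re-based bound -/

section Rebase

variable {σ : Type*} {K : Type*} [Field K] [Fintype σ] [DecidableEq σ] [DecidableEq K]
variable (p : ℕ) [hp : Fact p.Prime] [CharP K p]

omit [Fintype σ] [DecidableEq σ] hp [CharP K p] in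
/-- Moving by the zero vector and re-cleaning a clean state does nothing. [folklore] -/
theorem translate_zero_eq_self (s : CState σ K) (hclean : deletePthPowers p s.F = s.F) :
    (⟨deletePthPowers p (PointBlowup.translate (0 : σ → K) s.F),
        s.r.filter (fun i => (0 : σ → K) i = 0), s.exc.filter (fun i => (0 : σ → K) i = 0)⟩ :
      CState σ K) = s := by
  have hF : deletePthPowers p (PointBlowup.translate (0 : σ → K) s.F) = s.F := by
    rw [PointBlowup.translate_eq_self (0 : σ → K) (fun _ => rfl), hclean]
  have hr : s.r.filter (fun i => (0 : σ → K) i = 0) = s.r := by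
    ext i; rw [Finsupp.filter_apply, if_pos (show (0 : σ → K) i = 0 from rfl)]
  have he : s.exc.filter (fun i => (0 : σ → K) i = 0) = s.exc :=
    Finset.filter_true_of_mem fun _ _ => rfl
  rw [hF, hr, he]

omit [Fintype σ] hp [CharP K p] in
/-- Along a chain of steps the residual polynomial stays clean. [folklore] -/
theorem deletePthPowers_along (s : ℕ → CState σ K) (S : ℕ → Finset σ) (j : ℕ → σ) (b : ℕ → σ → K)
    (m : ℕ) (hstep : ∀ k, k < m → s (k + 1) = step p (S k) (j k) (b k) (s k))
    (hclean : deletePthPowers p (s 0).F = (s 0).F) :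
    ∀ k, k ≤ m → deletePthPowers p (s k).F = (s k).F := by
  intro k
  induction k with
  | zero => exact fun _ => hclean
  | succ k ih =>
    intro hk
    rw [hstep k (Nat.lt_of_succ_le hk)]
    exact deletePthPowers_step p (S k) (j k) (b k) (s k)

/-- **The re-based states of a nested, revisit-free zigzag form a fibre chain.** With accumulated moves
`Γ_m = 0`, `Γ_k = c_k + Γ_{k+1}|_{S_kᶜ}` (any `Γ` satisfying this recursion below the horizon `m`),
nesting `Γ_{k+1}(j_k) = 0` and no revisit at stage `k`, the state `s_{k+1}@Γ_{k+1}` is the fibre-point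
step, at `b'_k + Γ_{k+1}|_{S_k}`, of `s_k@Γ_k`. [folklore] -/
theorem rebase_succ (s : ℕ → CState σ K) (S : ℕ → Finset σ) (j : ℕ → σ) (b' c : ℕ → σ → K)
    (Γ : ℕ → σ → K) (m : ℕ) (hj : ∀ k, k < m → j k ∈ S k)
    (hb' : ∀ k, k < m → ∀ i, i ∉ S k → b' k i = 0) (hc : ∀ k, k < m → ∀ i ∈ S k, c k i = 0)
    (hstep : ∀ k, k < m → s (k + 1) = step p (S k) (j k) (b' k + c k) (s k))
    (hΓ : ∀ k, k < m → Γ k = c k + (S k).piecewise (0 : σ → K) (Γ (k + 1)))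
    (hnest : ∀ k, k < m → Γ (k + 1) (j k) = 0)
    (hret : ∀ k, k < m → ∀ i, i ≠ j k → (b' k + c k) i + Γ (k + 1) i = 0 → (b' k + c k) i = 0)
    (hclean : deletePthPowers p (s 0).F = (s 0).F) (k : ℕ) (hk : k < m) :
    (⟨deletePthPowers p (PointBlowup.translate (Γ (k + 1)) (s (k + 1)).F),
        (s (k + 1)).r.filter (fun i => Γ (k + 1) i = 0),
        (s (k + 1)).exc.filter (fun i => Γ (k + 1) i = 0)⟩ : CState σ K) =
      step p (S k) (j k) (b' k + (S k).piecewise (Γ (k + 1)) (0 : σ → K))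
        ⟨deletePthPowers p (PointBlowup.translate (Γ k) (s k).F),
          (s k).r.filter (fun i => Γ k i = 0), (s k).exc.filter (fun i => Γ k i = 0)⟩ := by
  rw [hstep k hk, hΓ k hk]
  exact translate_step_add_eq p (hj k hk) (b' k) (c k) (Γ (k + 1)) (hb' k hk) (hc k hk) (hnest k hk)
    (hret k hk) (s k) (deletePthPowers_along p s S j (fun k => b' k + c k) m hstep hclean k hk.le)

/-- **Moh's `+1` along a nested, revisit-free zigzag branch, RE-BASED.** Let
`s_{k+1} = step p S_k j_k (b'_k + c_k) s_k` (`k < m`) be a branch of blow-ups of coordinate centres read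
at arbitrary points (`b'_k` fibre coordinate, `c_k` on the centre), `s_0` clean with `F ≠ 0`,
`y^r ∣ F`; let `Γ` be the accumulated moves (`Γ_m = 0`, `Γ_k = c_k + Γ_{k+1}|_{S_kᶜ}`), NESTED
(`Γ_{k+1}(j_k) = 0`) and REVISIT-FREE; suppose condition (1) holds for `C_{S_k}` at `s_k` and condition
(2) at the re-based state `s_k@Γ_k`, for every `k < m`. Then for every `n ≤ m`:
`shade(s_m) ≤ shade(s_n@Γ_n) + 1` — the baseline of Moh's stability along a zigzag is the earlier state
MOVED TO THE COMPOSITE IMAGE POINT `Γ_n` (a point of `C_{S_n}`), not the earlier state itself.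
[cite: Moh1987, Stability Theorem (Introduction p. 966) and §1 (pp. 972–973)] -/
theorem shade_le_shade_rebase_add_one (s : ℕ → CState σ K) (S : ℕ → Finset σ) (j : ℕ → σ)
    (b' c : ℕ → σ → K) (Γ : ℕ → σ → K) (m : ℕ) (hj : ∀ k, k < m → j k ∈ S k)
    (hb'j : ∀ k, k < m → b' k (j k) = 0) (hb' : ∀ k, k < m → ∀ i, i ∉ S k → b' k i = 0)
    (hc : ∀ k, k < m → ∀ i ∈ S k, c k i = 0)
    (hstep : ∀ k, k < m → s (k + 1) = step p (S k) (j k) (b' k + c k) (s k))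
    (hΓm : Γ m = 0) (hΓ : ∀ k, k < m → Γ k = c k + (S k).piecewise (0 : σ → K) (Γ (k + 1)))
    (hnest : ∀ k, k < m → Γ (k + 1) (j k) = 0)
    (hret : ∀ k, k < m → ∀ i, i ≠ j k → (b' k + c k) i + Γ (k + 1) i = 0 → (b' k + c k) i = 0)
    (hF0 : (s 0).F ≠ 0) (hclean : deletePthPowers p (s 0).F = (s 0).F)
    (hr : ∀ d ∈ (s 0).F.support, (s 0).r ≤ d)
    (hq : ∀ k, k < m → ∀ d ∈ (s k).F.support, p ≤ degIn (S k) d)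
    (hperm : ∀ k, k < m →
      ((degIn (S k) ((s k).r.filter (fun i => Γ k i = 0)) : ℕ) : ℕ∞) +
          CState.shade ⟨deletePthPowers p (PointBlowup.translate (Γ k) (s k).F),
            (s k).r.filter (fun i => Γ k i = 0), (s k).exc.filter (fun i => Γ k i = 0)⟩ ≤
        ordAlong (S k) (deletePthPowers p (PointBlowup.translate (Γ k) (s k).F)))
    {n : ℕ} (hnm : n ≤ m) :
    (s m).shade ≤ CState.shade ⟨deletePthPowers p (PointBlowup.translate (Γ n) (s n).F),
      (s n).r.filter (fun i => Γ n i = 0), (s n).exc.filter (fun i => Γ n i = 0)⟩ + 1 := by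
  -- the honest chain
  let σ' : ℕ → CState σ K := fun k => ⟨deletePthPowers p (PointBlowup.translate (Γ k) (s k).F),
    (s k).r.filter (fun i => Γ k i = 0), (s k).exc.filter (fun i => Γ k i = 0)⟩
  have hσdef : ∀ k, σ' k = ⟨deletePthPowers p (PointBlowup.translate (Γ k) (s k).F),
    (s k).r.filter (fun i => Γ k i = 0), (s k).exc.filter (fun i => Γ k i = 0)⟩ := fun k => rfl
  have hcleank := deletePthPowers_along p s S j (fun k => b' k + c k) m hstep hclean
  have hΓS : ∀ k, k < m → ∀ i ∈ S k, Γ k i = 0 := fun k hk i hi => by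
    rw [hΓ k hk, Pi.add_apply, hc k hk i hi, Finset.piecewise, if_pos hi, Pi.zero_apply, add_zero]
  have hσm : σ' m = s m := translate_zero_eq_self p (s m) (hcleank m le_rfl) ▸ (by
    show σ' m = _; rw [hσdef m, hΓm])
  have hstepσ : ∀ k, k < m →
      σ' (k + 1) = step p (S k) (j k) (b' k + (S k).piecewise (Γ (k + 1)) (0 : σ → K)) (σ' k) :=
    fun k hk => rebase_succ p s S j b' c Γ m hj hb' hc hstep hΓ hnest hret hclean k hk
  have hβj : ∀ k, k < m → (b' k + (S k).piecewise (Γ (k + 1)) (0 : σ → K)) (j k) = 0 := fun k hk => by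
    rw [Pi.add_apply, hb'j k hk, Finset.piecewise, if_pos (hj k hk), hnest k hk, add_zero]
  have hβN : ∀ k, k < m → ∀ i, i ∉ S k → (b' k + (S k).piecewise (Γ (k + 1)) (0 : σ → K)) i = 0 :=
    fun k hk i hi => by rw [Pi.add_apply, hb' k hk i hi, Finset.piecewise, if_neg hi, Pi.zero_apply, add_zero]
  have hF0σ : (σ' 0).F ≠ 0 := clean_translate_ne_zero p (Γ 0) hclean hF0
  have hcleanσ : deletePthPowers p (σ' 0).F = (σ' 0).F := PointBlowup.deletePthPowers_deletePthPowers p _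
  have hrσ : ∀ d ∈ (σ' 0).F.support, (σ' 0).r ≤ d := fun d hd =>
    filter_le_of_mem_support_clean_translate p (Γ 0) hr hd
  have hqσ : ∀ k, k < m → ∀ d ∈ (σ' k).F.support, p ≤ degIn (S k) d := fun k hk d hd =>
    le_degIn_of_mem_support_clean_translate p (Γ k) (hΓS k hk) (hq k hk) hd
  have hpermσ : ∀ k, k < m → ∀ d ∈ (σ' k).F.support,
      ((degIn (S k) (σ' k).r : ℕ) : ℕ∞) + (σ' k).shade ≤ (degIn (S k) d : ℕ) := fun k hk d hd =>
    le_trans (hperm k hk) (ordAlong_le_of_mem_support hd)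
  have h := shade_le_shade_add_one_along_fin p σ' S j
    (fun k => b' k + (S k).piecewise (Γ (k + 1)) (0 : σ → K)) m hj hβj hβN hstepσ hF0σ hcleanσ hrσ hqσ
    hpermσ hnm
  rw [hσm] at h
  exact h

end Rebase

end MohAlong

end Summit.ResolutionOfSingularities.ResolutionOfSingularities.Theorems.PIDim4

end
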